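/- Copyright: the b2b-balaban cell (near-miss cell 7), T⁴-continuum fan-out, NE7b CRUX team (2), leaf lineage
t4-ne7b-formalise-leaf-02 (gen 29) on the row-NE7b OWNER t4-ne7b-p1 g47's INTERFACE REQUEST NE7b IR-47-1 «DISTINCT AND BOXED
ON PASS V» (R-OWNER-47-2 (B), journal l.31988) as corrected by the located finding F-ne7bleaf02g29-1 (journal l.32013;
leaf-05's PASS + CONCUR W-ne7bleaf05-g31-1, l.32044) — PART 2 of 3, the label-guarded display.  Released under the licence
of the surrounding project. -/
import Summits.QuantumFields.BalabanUV.T4Continuum.Support.HistoryRealiseDistinct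

/-!
# Realised histories with distinct constituents — THE LABEL-GUARDED DISPLAY `DisjointJoinsL` (row S1c-opt, repair of
finding F-ne7bleaf02g29-1 (a)): definition, the abstract duplicate-freeness lemma VERBATIM for it, and the decided toy
on which the unguarded display fails

Summits-side support leaf of the T⁴-continuum cell (rung (B)+1 on a FINITE torus only; NOT infinite volume, NOT the
mass gap, NOT the Clay statement; NOT a proof of the spine estimate NE7b, which is the cell's OWN estimate, NOT PRINTED
and NOT PROVED).  [folklore] structural recursion over the census carrier `PGen` ∕ `PGen.pbirths` and row S1c-opt's
displays (`HistoryRealiseDistinct`: `DisjointJoins`, `BoxedBirths`, `InBoxAt`, `nodup_map_pbirths`); nothing printed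
is asserted, no `def … : Prop` fact of Bałaban's (the `def`s below are PREDICATES WITH PARAMETERS — displayed reading
side conditions, consumed only as binders), no cite-tagged hypothesis, zero `sorry`.

WHY (finding F-ne7bleaf02g29-1 (a), journal l.32013; leaf-05 CONCUR l.32044).  `HistoryRealiseDistinct.DisjointJoins`
asks, at every join, the regions of ANY birth of one partner and ANY birth of the other to be disjoint AS RAW INDEX
SETS — across steps.  In the pass-V reading the regions born at different steps live in different cube lattices (an old
line enters level `ℓ` through `Sop (ratio L s (ℓ−1))`), the input display `NewDisjoint` separates the new regions of
ONE step only, and a new region index-meeting an earlier-step constituent of the line it joins violates the clause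
(§3's toy: the level-0 cube `0` joined at step 1 by the level-1 cube `0`) — so the unguarded display is FALSE on
admissible inputs and cannot be derived.  Its one unfolding consumer `nodup_map_pbirths` uses the clause ONLY for two
births of EQUAL LABEL (`:176–179`).  The guarded display below is therefore (i) what the END consumes, (ii) derivable on
pass V (PART 3, `HistoryGenealogyJunctionVDistinct.disjointJoinsL_pedV`).  Matching the VS-witness's field
`disjointJoins` then needs the owner's ruling: (R-a) re-define `DisjointJoins` with the guard (one landed file; all
consumers by name), or (R-b) re-type the field to `DisjointJoinsL` at the next witness version.

WHAT.  §1 **`DisjointJoinsL`** (join clause `b.1 = b'.1 → Disjoint b.2.2 b'.2.2`), unfoldings, `disjointJoinsL_of_disjointJoins`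
(the strong display implies it), the cross clause `CrossL`, `disjointJoinsL_chainJoin`∕`disjointJoinsL_joinP` (a chain of
joins is guarded-disjoint iff its links are and they are pairwise cross-disjoint — the shape PART 3 feeds).  §2
**`nodup_map_pbirths_L`** and **`hdis_of_displaysL`** — row S1c-opt's abstract lemma and its display-to-display form,
VERBATIM for the guarded display (so every `hdis` consumer loses nothing under (R-a)∕(R-b)).  §3 sanity (decided,
`d = 1`): `not_disjointJoins_nestedToy` (the STRONG display fails on the nested two-step toy), `disjointJoinsL_nestedToy`
(the guarded one holds).

HONEST.  Bookkeeping over OUR carriers; `DisjointJoinsL` is a DISPLAYED reading side condition like its parent;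
proves nothing of Bałaban's; NE7b NOT proved; spine 0∕9.
HONEST DEPENDENCY (cell): continuum YM on T⁴ ⇐ BetaPertH ∧ nine spine estimates (0/9 proved); BetaPertH ⇐ (D1) ∧ (D4)
∧ CAP+tail; G-an2-4 gates asym, D1 and NE2/3/4.  This file changes none of it. -/

open Finset
open Literature.MathematicalPhysics.QuantumFieldTheory.Balaban1983to89
open Literature.MathematicalPhysics.QuantumFieldTheory.Balaban1983to89.B13ScaleTransfer
open T4PersistenceDictionary
open Summit.QuantumFields.BalabanUV.T4Continuum.HistoryAdmissible
open Summit.QuantumFields.BalabanUV.T4Continuum.HistoryRealise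
open Summit.QuantumFields.BalabanUV.T4Continuum.HistoryRealiseDistinct
open Summit.QuantumFields.BalabanUV.T4Continuum.HistoryGen

namespace Summit.QuantumFields.BalabanUV.T4Continuum.HistoryRealiseDistinctGuarded

variable {d : ℕ}

/-! ## §1 The guarded display, its unfoldings, chains of joins -/

/-- **`DisjointJoinsL g`** — at every join of the physical genealogy, two births of the two partners WITH THE SAME
LABEL (same step, same class) have DISJOINT regions.  The guarded form of row S1c-opt's `DisjointJoins` (which has no
guard and compares index sets across steps); it is exactly what `nodup_map_pbirths` consumes. [folklore] -/
def DisjointJoinsL : PGen (Pt d × Finset (Pt d)) → Prop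
  | .birth _ _ _ => True
  | .renew G _ => DisjointJoinsL G
  | .join X Y _ => DisjointJoinsL X ∧ DisjointJoinsL Y ∧
      ∀ b ∈ X.pbirths, ∀ b' ∈ Y.pbirths, b.1 = b'.1 → Disjoint b.2.2 b'.2.2

/-- unfolding at a birth [folklore] -/
@[simp] theorem disjointJoinsL_birth (j cls : ℕ) (zZ : Pt d × Finset (Pt d)) :
    DisjointJoinsL (.birth j cls zZ) := trivial

/-- unfolding at a renewal [folklore] -/
@[simp] theorem disjointJoinsL_renew (G : PGen (Pt d × Finset (Pt d))) (h : ℕ) :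
    DisjointJoinsL (.renew G h) ↔ DisjointJoinsL G := Iff.rfl

/-- unfolding at a join [folklore] -/
theorem disjointJoinsL_join (X Y : PGen (Pt d × Finset (Pt d))) (s : ℕ) :
    DisjointJoinsL (.join X Y s) ↔ DisjointJoinsL X ∧ DisjointJoinsL Y ∧
      ∀ b ∈ X.pbirths, ∀ b' ∈ Y.pbirths, b.1 = b'.1 → Disjoint b.2.2 b'.2.2 := Iff.rfl

/-- the strong display implies the guarded one [folklore] -/
theorem disjointJoinsL_of_disjointJoins : ∀ g : PGen (Pt d × Finset (Pt d)), DisjointJoins g → DisjointJoinsL g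
  | .birth _ _ _, _ => trivial
  | .renew G _, h => disjointJoinsL_of_disjointJoins G h
  | .join X Y _, ⟨hX, hY, hXY⟩ =>
      ⟨disjointJoinsL_of_disjointJoins X hX, disjointJoinsL_of_disjointJoins Y hY, fun b hb b' hb' _ => hXY b hb b' hb'⟩

/-- the guarded CROSS clause between two genealogies [folklore] -/
def CrossL (X Y : PGen (Pt d × Finset (Pt d))) : Prop :=
  ∀ b ∈ X.pbirths, ∀ b' ∈ Y.pbirths, b.1 = b'.1 → Disjoint b.2.2 b'.2.2

/-- `DisjointJoinsL` along a chain of joins: each link guarded-disjoint, links pairwise cross-disjoint [folklore] -/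
theorem disjointJoinsL_chainJoin (s : ℕ) : ∀ (A : PGen (Pt d × Finset (Pt d))) (Bs : List (PGen (Pt d × Finset (Pt d)))),
    DisjointJoinsL A → (∀ B ∈ Bs, DisjointJoinsL B) → (∀ B ∈ Bs, CrossL A B) → Bs.Pairwise CrossL →
      DisjointJoinsL (chainJoin A Bs s)
  | A, [], hA, _, _, _ => hA
  | A, B :: Bs, hA, hBs, hX, hP => by
      rw [List.pairwise_cons] at hP
      rw [chainJoin]
      refine disjointJoinsL_chainJoin s (PGen.join A B s) Bs ⟨hA, hBs B List.mem_cons_self, hX B List.mem_cons_self⟩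
        (fun B' h => hBs B' (List.mem_cons_of_mem _ h)) (fun B' hB' => ?_) hP.2
      intro b hb b' hb' hl
      rw [PGen.pbirths_join, Multiset.mem_add] at hb
      rcases hb with hb | hb
      · exact hX B' (List.mem_cons_of_mem _ hB') b hb b' hb' hl
      · exact hP.1 B' hB' b hb b' hb' hl

/-- `DisjointJoinsL` of a nonempty join of part `PGen`s [folklore] -/
theorem disjointJoinsL_joinP {α π : Type*} (P : Pedigree α π) (c : α) {L : List (PGen (Pt d × Finset (Pt d)))}
    (hL : L ≠ []) (hA : ∀ A ∈ L, DisjointJoinsL A) (hP : L.Pairwise CrossL) : DisjointJoinsL (P.joinP c L) := by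
  obtain ⟨A, As, rfl⟩ := List.exists_cons_of_ne_nil hL
  rw [List.pairwise_cons] at hP
  simp only [Pedigree.joinP]
  exact disjointJoinsL_chainJoin _ A As (hA A List.mem_cons_self) (fun B hB => hA B (List.mem_cons_of_mem _ hB))
    hP.1 hP.2

/-! ## §2 The abstract duplicate-freeness lemma holds verbatim for the guarded display -/

/-- **`nodup_map_pbirths` FOR `DisjointJoinsL`** — row S1c-opt's abstract lemma (`HistoryRealiseDistinct.nodup_map_pbirths`)
with the guarded display: its join case invokes disjointness only for an `X`-birth and a `Y`-birth of EQUAL label.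
[folklore] -/
theorem nodup_map_pbirths_L {ν : Type*} (v : PEv → Pt d × Finset (Pt d) → ν) :
    ∀ g : PGen (Pt d × Finset (Pt d)), DisjointJoinsL g → (∀ b ∈ g.pbirths, b.2.1 ∈ b.2.2) →
      (∀ b ∈ g.pbirths, ∀ b' ∈ g.pbirths, b.1 = b'.1 → v b.1 b.2 = v b'.1 b'.2 → b.2.2 = b'.2.2) →
      (g.pbirths.map (fun bz => (bz.1, v bz.1 bz.2))).Nodup
  | .birth j cls zZ, _, _, _ => by
      rw [PGen.pbirths_birth, Multiset.map_singleton]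
      exact Multiset.nodup_singleton _
  | .renew G hh, hd, hne, hinj => by
      rw [PGen.pbirths_renew] at hne hinj ⊢
      exact nodup_map_pbirths_L v G hd hne hinj
  | .join X Y sj, hd, hne, hinj => by
      obtain ⟨hdX, hdY, hXY⟩ := hd
      rw [PGen.pbirths_join] at hne hinj ⊢
      rw [Multiset.map_add, Multiset.nodup_add]
      refine ⟨nodup_map_pbirths_L v X hdX (fun b hb => hne b (Multiset.mem_add.2 (Or.inl hb)))
          (fun b hb b' hb' => hinj b (Multiset.mem_add.2 (Or.inl hb)) b' (Multiset.mem_add.2 (Or.inl hb'))),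
        nodup_map_pbirths_L v Y hdY (fun b hb => hne b (Multiset.mem_add.2 (Or.inr hb)))
          (fun b hb b' hb' => hinj b (Multiset.mem_add.2 (Or.inr hb)) b' (Multiset.mem_add.2 (Or.inr hb'))), ?_⟩
      refine Multiset.disjoint_left.2 ?_
      intro w hwX hwY
      obtain ⟨b, hb, rfl⟩ := Multiset.mem_map.1 hwX
      obtain ⟨b', hb', hbb'⟩ := Multiset.mem_map.1 hwY
      obtain ⟨h1, h2⟩ := Prod.mk.inj hbb'
      have hreg : b.2.2 = b'.2.2 :=
        hinj b (Multiset.mem_add.2 (Or.inl hb)) b' (Multiset.mem_add.2 (Or.inr hb')) h1.symm h2.symm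
      have hdis : Disjoint b.2.2 b'.2.2 := hXY b hb b' hb' h1.symm
      have hmem : b.2.1 ∈ b.2.2 := hne b (Multiset.mem_add.2 (Or.inl hb))
      rw [hreg] at hdis hmem
      exact Finset.disjoint_left.1 hdis hmem hmem

/-- **`hdis` FROM THE GUARDED DISPLAYS** (display-to-display form, as `HistoryRealiseDistinct.hdis_of_displays`).
[folklore] -/
theorem hdis_of_displaysL {ν : Type*} {n L K : ℕ} {lv : ℕ → ℕ} {g : PGen (Pt d × Finset (Pt d))}
    (v : PEv → Pt d × Finset (Pt d) → ν)
    (hd : DisjointJoinsL g) (hB : BoxedBirths n L K lv g) (hne : ∀ b ∈ g.pbirths, b.2.1 ∈ b.2.2)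
    (hv : ∀ b ∈ g.pbirths, ∀ b' ∈ g.pbirths, b.1 = b'.1 →
      (∀ x ∈ b.2.2, InBoxAt n L K lv (PEv.step b.1) x) → (∀ x ∈ b'.2.2, InBoxAt n L K lv (PEv.step b'.1) x) →
      b.2.1 ∈ b.2.2 → b'.2.1 ∈ b'.2.2 → v b.1 b.2 = v b'.1 b'.2 → b.2.2 = b'.2.2) :
    (g.pbirths.map (fun bz => (bz.1, v bz.1 bz.2))).Nodup :=
  nodup_map_pbirths_L v g hd hne
    (fun b hb b' hb' hl hvv => hv b hb b' hb' hl (hB b hb) (hB b' hb') (hne b hb) (hne b' hb') hvv)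

/-! ## §3 Sanity (decided, `d = 1`): the strong display fails on a nested two-step toy, the guarded one holds -/

namespace Sanity

/-- the unit region at the origin of the line, as (anchor, region) -/
def reg0 : Pt 1 × Finset (Pt 1) := (fun _ => 0, {fun _ => 0})

/-- the TOY of finding F-ne7bleaf02g29-1 (a): the level-0 cube `0` born at step `0`, joined at step `1` by the level-1
cube `0` born at step `1` — the same raw index set at two DIFFERENT steps (nested cubes, as when a new region sits on
an old line). [folklore] -/
def nestedToy : PGen (Pt 1 × Finset (Pt 1)) := .join (.birth 0 1 reg0) (.birth 1 1 reg0) 1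

/-- the STRONG display fails on the nested toy: it asks `Disjoint {0} {0}` across steps [folklore] -/
theorem not_disjointJoins_nestedToy : ¬ DisjointJoins nestedToy := by
  intro h
  obtain ⟨-, -, hXY⟩ := (disjointJoins_join _ _ _).1 h
  have := hXY (((0, 0, 1) : PEv), reg0) (by simp [PGen.pbirths_birth]) (((1, 0, 1) : PEv), reg0)
    (by simp [PGen.pbirths_birth])
  exact absurd this (by simp [reg0])

/-- the GUARDED display holds on the nested toy: the two births have different labels (steps `0 ≠ 1`) [folklore] -/
theorem disjointJoinsL_nestedToy : DisjointJoinsL nestedToy := by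
  refine ⟨trivial, trivial, fun b hb b' hb' hl => ?_⟩
  simp only [PGen.pbirths_birth, Multiset.mem_singleton] at hb hb'
  subst hb; subst hb'
  exact absurd (congrArg PEv.step hl) (by simp)

end Sanity

end Summit.QuantumFields.BalabanUV.T4Continuum.HistoryRealiseDistinctGuarded
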